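import Literature.AlgebraicGeometry.HodgeTheory.CubicFourfoldHodgeConjecture
import Literature.AlgebraicGeometry.HodgeTheory.HodgeConjecture
import Literature.AlgebraicGeometry.HodgeTheory.LefschetzOneOne
import Literature.AlgebraicGeometry.HodgeTheory.HardLefschetzNFold
import HarnessLib

/-!
# The Hodge conjecture for cubic fourfolds in every codimension (proof file; no new named fact)

Family `hodge`, layer `Literature/AlgebraicGeometry/HodgeTheory`. Companion of
`CubicFourfoldHodgeConjecture` (named fact `hodgeTwoTwo_algebraic_cubicFourfold`: Zucker 1977
(3.2) Theorem p. 206 / Murre 1977 Corollary p. 230 — every rational `(2,2)`-class on a smooth cubic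
fourfold is algebraic). Murre, Indag. Math. 80 (1977), p. 230, Remark 1, verbatim (held copy read):
"It is well-known that the `(1,1)` and `(3,3)`-conjecture are true for any fourfold." — i.e. Lefschetz
`(1,1)` and its hard-Lefschetz dual. This file PROVES, from that fact and the tree's existing named
facts (D-0026: nothing new is asserted):

* `hodgeClasses_algebraic_cubicFourfold_of` — rational `(p,p)`-classes on a smooth cubic fourfold are
  algebraic in EVERY codimension `p`: `p = 0` by `algebraicClasses_zero`, `p = 1` by Lefschetz `(1,1)`
  (`lefschetzOneOne_rational`, Voisin I Thm. 11.30), `p = 2` the fact, `p ≥ 3` by hard Lefschetz from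
  codimension `4 - p ≤ 1` (`nonempty_hardLefschetzNFold 4 X`, Voisin I Thm. 6.25, through the tree's
  `mem_algebraicClasses_of_lt_of_nonempty`);
* `hodgeConjectureFor_cubicFourfold_of` — with the anti-vacuity conjunct (`nonempty_hodgeModel`),
  `HodgeConjectureFor 4 X` in the summit layer's spelling: "S. Zucker has proved the Hodge conjecture
  for cubic fourfolds" (Murre p. 230).

Consumer: calibration of the crux `VerticalSupportFourfolds` (stmt-HodgeConjecture-2784) of route
`HodgeConjecture/CurveNetMordellWeil` (known cases of HC for fourfolds, in the summit's spelling).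

## References

* [Murre1977] J. P. Murre, On the Hodge conjecture for unirational fourfolds, Indag. Math. 80 (1977)
  230–232: Theorem, Remark 1 and Corollary (p. 230).
* [Zucker1977] S. Zucker, The Hodge conjecture for cubic fourfolds, Compositio Math. 34 (1977)
  199–209, (3.2) Theorem p. 206.
* [VoisinHodgeI2002] C. Voisin, Hodge Theory and Complex Algebraic Geometry I, Thm. 6.25, Thm. 11.30.
* [Deligne2000] P. Deligne, The Hodge conjecture, Clay Mathematics Institute (2000), §1.
-/

noncomputable section

namespace Literature.AlgebraicGeometry.HodgeTheory

section HodgeTheory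

variable {X : Motives.SchemeOver ℂ}

/-- **Rational `(p,p)`-classes on a smooth cubic fourfold are algebraic in every codimension `p`**
(the fact at `p = 2`; Murre's Remark 1 — Lefschetz `(1,1)` `hL` and hard Lefschetz `hHL` — for
`p = 1, 3`; `p = 0` and `p ≥ 4` trivial / hard Lefschetz from codimension `0`).
[cite: Murre1977, Theorem, Remark 1 and Corollary (p. 230)] [cite: Zucker1977, (3.2) Theorem, p. 206]
[cite: VoisinHodgeI2002, Thm. 6.25 and Thm. 11.30] -/
theorem hodgeClasses_algebraic_cubicFourfold_of (h : hodgeTwoTwo_algebraic_cubicFourfold)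
    (hL : lefschetzOneOne_rational) (hHL : nonempty_hardLefschetzNFold 4 X)
    (hX : Motives.IsSmoothHypersurface 4 3 X) (p : ℕ)
    (c : Literature.AlgebraicTopology.SingularHomology.singularCohomology ℂ ℂ (Motives.ComplexPoints X) (2 * p))
    (hc : IsRationalClass c) (hpp : IsOfHodgeType 4 X (2 * p) p p c) : c ∈ algebraicClasses X p := by
  -- the codimensions `q ≤ 2` directly
  have low : ∀ q : ℕ, q ≤ 2 →
      ∀ c' : Literature.AlgebraicTopology.SingularHomology.singularCohomology ℂ ℂ (Motives.ComplexPoints X) (2 * q),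
        IsRationalClass c' → IsOfHodgeType 4 X (2 * q) q q c' → c' ∈ algebraicClasses X q := by
    intro q hq c' hc' hqq
    interval_cases q
    · rw [algebraicClasses_zero]
      exact Submodule.mem_top
    · exact hL hX.1 c' hc' hqq
    · exact h hX c' hc' hqq
  by_cases hp : p ≤ 2
  · exact low p hp c hc hpp
  · -- `p ≥ 3`: hard Lefschetz from codimension `4 - p ≤ 1`
    exact mem_algebraicClasses_of_lt_of_nonempty hHL hX.1 (by omega) (low (4 - p) (by omega)) c hc hpp

/-- **The Hodge conjecture holds for smooth cubic fourfolds**, in the summit layer's spelling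
`HodgeConjectureFor 4 X`: the fact, Lefschetz `(1,1)`, hard Lefschetz, and the existence of a Hodge
model (`hA`, the anti-vacuity conjunct). [cite: Murre1977, Theorem and Corollary (p. 230)]
[cite: Zucker1977, (3.2) Theorem, p. 206] [cite: Deligne2000, §1] -/
theorem hodgeConjectureFor_cubicFourfold_of (h : hodgeTwoTwo_algebraic_cubicFourfold)
    (hL : lefschetzOneOne_rational) (hHL : nonempty_hardLefschetzNFold 4 X)
    (hA : nonempty_hodgeModel 4 X) (hX : Motives.IsSmoothHypersurface 4 3 X) :
    HodgeConjectureFor 4 X :=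
  ⟨hA hX.1, fun p c hc hpp ↦ hodgeClasses_algebraic_cubicFourfold_of h hL hHL hX p c hc hpp⟩

/-- Upper bound (sanity): conversely `HodgeConjectureFor 4 X` contains the all-codimension statement,
so nothing beyond the summit statement is proved here. [cite: Deligne2000, §1] -/
theorem hodgeClasses_algebraic_cubicFourfold_of_hodgeConjectureFor (hX4 : HodgeConjectureFor 4 X)
    (p : ℕ)
    (c : Literature.AlgebraicTopology.SingularHomology.singularCohomology ℂ ℂ (Motives.ComplexPoints X) (2 * p))
    (hc : IsRationalClass c) (hpp : IsOfHodgeType 4 X (2 * p) p p c) : c ∈ algebraicClasses X p :=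
  hX4.2 p c hc hpp

end HodgeTheory

end Literature.AlgebraicGeometry.HodgeTheory

end
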